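import Summits.CriticalPhenomena.PercolationContinuityZ3.Theorems.PercNearOneGluingNoHeavyLowerTailKnQuestion8CoefficientwiseCoreClassDomLeafClusters
import HarnessLib

/-!
# THEOREM LEAF: a proper domination map of `(H; a, b)` gives the core-class kernel for `H` with a new terminal leaf `a′–a`

Support file (`--supports stmt-CriticalPhenomena-4575`, closed), prover `prim-cplus-coupling` (gen 30).  No definitions, no notations, no named facts,
no sorries; standard axioms.  Memo `prim-cplus-coupling/A5-COUPLING-gen30.md` §3.2–§3.3.  Companions `…CoreClassDom` (THEOREM KB-DOM), `…CoreClassDomPocketFree`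
(THEOREM R_A-DOM), `…CoreClassDomBundle`, `…CoreClassDomParallel`.

Setting: middle graph `E` with terminals `a, b`; a NEW edge `e ∉ E` with `ends e = s(a′, a)`, `a′` on no edge of `E`, `a′ ≠ a, b`; the enlarged middle graph
`E′ = insert e E` with terminals `a′, b` ('a terminal leaf hung at `a`').  Domination maps do not survive this operation (exact census: the seven taut two-terminal
graphs on 8 vertices without a domination map are all 'leaf + bundle + leaf', memo §2.3), but the KERNEL does, given a PROPER domination map `ψ` of `(E; a, b)`
(one whose image avoids `{b ∈ R_a}`; the involution `R_A` of `…CoreClassDomPocketFree` and the parallel products of `…CoreClassDomParallel` are proper):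
(pendant-edge cluster identities and the product-form Harris inequality are in `…CoreClassDomLeafClusters`)
* `Coefficientwise.coreClass_kernel_nonneg_leaf` — the core-class kernel of `(E′; a′, b)` is `≥ 0` for every monotone `f` (`f ∅ = 0`) and monotone `g`.
  Proof (memo §3.3): peel the leaf edge; the `e`-blue wall configurations are paid termwise by the first Harris family through the colour swap; the `T_H`-part of the
  `e`-red wall configurations by the second Harris family through `ψ`; the remaining `e`-red wall configurations (`a, b` blue-joined, not red-joined in `H`) by the
  two families' terms at the red-joined configurations, via ONE two-colouring Harris inequality `Σ F(ω)G(E∖ω) ≤ Σ F(ω)G(ω)` (`F = f(a′ ∪ R_a)`,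
  `G = (g(S_H) − g ∅)·1[b ∈ R_a, a ∉ B_b]`, both increasing) — the negative dependence of the red cluster of `a` and the blue cluster of `b`.
The CW-PA wrapper for the core class over `E′` is `…CoreClassDomLeafMain`.
[cite: KozmaNitzan2024, Questions 8–9 (§5.5 p. 36) (context: the Question-8 pocket covariance programme)]
-/

namespace Summit.CriticalPhenomena.PercolationContinuityZ3.Theorems

open Finset Literature.Probability.Percolation

namespace Coefficientwise

variable {ι V : Type*}

open Classical in
/-- **THEOREM LEAF (kernel).**  Middle graph `E` with terminals `a, b`, a new edge `e ∉ E` with `ends e = s(a′, a)`, `a′` on no edge of `E`, `a′ ≠ a`, `a′ ≠ b`,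
and a PROPER domination map `ψ` of `(E; a, b)` (`ψ ω ⊆ E`, injective on the wall event `{b ∉ C_a ω, b ∉ C_a(E∖ω)}`, `C_a ω ∪ C_b(E∖ω) ⊆ C_a(ψω) ∪ C_b(ψω)` and
`b ∉ C_a(ψ ω)` there).  Then the core-class kernel of the enlarged middle graph `(insert e E; a′, b)` is nonnegative for every monotone `f` with `f ∅ = 0` and
every monotone `g`:
`0 ≤ Σ_{ω′ ⊆ E′} f(R′_{a′} ∪ R′_b)(g(R′_{a′} ∪ R′_b) − g ∅) + Σ_{ω′ ⊆ E′ : b ∉ R′_{a′}, b ∉ B′_{a′}} [f(R′_{a′})(g R′_{a′} − g B′_b) + f(R′_b)(g R′_b − g B′_{a′})]`.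
[cite: KozmaNitzan2024, Questions 8–9 (§5.5 p. 36) (context)] -/
theorem coreClass_kernel_nonneg_leaf (ends : ι → Sym2 V) (E : Finset ι) (e : ι) (a a' b : V) (he : e ∉ E) (hends : ends e = s(a', a))
    (ha'E : ∀ i ∈ E, a' ∉ ends i) (ha'a : a' ≠ a) (ha'b : a' ≠ b)
    (f g : Set V → ℝ) (hf : Monotone f) (hf0 : f ∅ = 0) (hg : Monotone g) (ψ : Finset ι → Finset ι)
    (hψE : ∀ ω, ω ⊆ E → b ∉ openCluster (ends '' (↑ω : Set ι)) a → b ∉ openCluster (ends '' (↑(E \ ω) : Set ι)) a → ψ ω ⊆ E)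
    (hψcov : ∀ ω, ω ⊆ E → b ∉ openCluster (ends '' (↑ω : Set ι)) a → b ∉ openCluster (ends '' (↑(E \ ω) : Set ι)) a →
      openCluster (ends '' (↑ω : Set ι)) a ∪ openCluster (ends '' (↑(E \ ω) : Set ι)) b ⊆
        openCluster (ends '' (↑(ψ ω) : Set ι)) a ∪ openCluster (ends '' (↑(ψ ω) : Set ι)) b)
    (hψinj : ∀ ω₁ ω₂, ω₁ ⊆ E → b ∉ openCluster (ends '' (↑ω₁ : Set ι)) a → b ∉ openCluster (ends '' (↑(E \ ω₁) : Set ι)) a →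
      ω₂ ⊆ E → b ∉ openCluster (ends '' (↑ω₂ : Set ι)) a → b ∉ openCluster (ends '' (↑(E \ ω₂) : Set ι)) a → ψ ω₁ = ψ ω₂ → ω₁ = ω₂)
    (hψprop : ∀ ω, ω ⊆ E → b ∉ openCluster (ends '' (↑ω : Set ι)) a → b ∉ openCluster (ends '' (↑(E \ ω) : Set ι)) a →
      b ∉ openCluster (ends '' (↑(ψ ω) : Set ι)) a) :
    0 ≤ (∑ ω ∈ (insert e E).powerset,
        f (openCluster (ends '' (↑ω : Set ι)) a' ∪ openCluster (ends '' (↑ω : Set ι)) b) *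
          (g (openCluster (ends '' (↑ω : Set ι)) a' ∪ openCluster (ends '' (↑ω : Set ι)) b) - g ∅))
      + ∑ ω ∈ (insert e E).powerset.filter (fun ω : Finset ι => b ∉ openCluster (ends '' (↑ω : Set ι)) a' ∧
            b ∉ openCluster (ends '' (↑((insert e E) \ ω) : Set ι)) a'),
        (f (openCluster (ends '' (↑ω : Set ι)) a') * (g (openCluster (ends '' (↑ω : Set ι)) a') - g (openCluster (ends '' (↑((insert e E) \ ω) : Set ι)) b))
          + f (openCluster (ends '' (↑ω : Set ι)) b) * (g (openCluster (ends '' (↑ω : Set ι)) b) - g (openCluster (ends '' (↑((insert e E) \ ω) : Set ι)) a'))) := by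
  -- abbreviations
  set C : Finset ι → V → Set V := fun ω v => openCluster (ends '' (↑ω : Set ι)) v with hC
  set E' : Finset ι := insert e E with hE'
  set D' : Finset (Finset ι) := E'.powerset.filter (fun ω => b ∉ C ω a' ∧ b ∉ C (E' \ ω) a') with hD'
  change 0 ≤ (∑ ω ∈ E'.powerset, f (C ω a' ∪ C ω b) * (g (C ω a' ∪ C ω b) - g ∅)) +
    ∑ ω ∈ D', (f (C ω a') * (g (C ω a') - g (C (E' \ ω) b)) + f (C ω b) * (g (C ω b) - g (C (E' \ ω) a')))
  have hf_nonneg : ∀ X : Set V, 0 ≤ f X := fun X => by rw [← hf0]; exact hf (Set.empty_subset X)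
  have hk_nonneg : ∀ X : Set V, 0 ≤ g X - g ∅ := fun X => by linarith [hg (Set.empty_subset X)]
  have hCmono : ∀ {ω ω' : Finset ι} (v : V), ω ⊆ ω' → C ω v ⊆ C ω' v := fun v h => openCluster_image_mono ends h v
  -- (1) symmetrise the second anti term by the colour swap inside `E'`
  have hswap : ∑ ω ∈ D', f (C ω b) * (g (C ω b) - g (C (E' \ ω) a')) =
      ∑ ω ∈ D', f (C (E' \ ω) b) * (g (C (E' \ ω) b) - g (C ω a')) := by
    have h := sum_powerset_filter_sdiff E' (fun ω : Finset ι => b ∉ C ω a' ∧ b ∉ C (E' \ ω) a')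
      (fun s hs => by rw [Finset.sdiff_sdiff_eq_self hs]; exact and_comm)
      (fun ω => f (C ω b) * (g (C ω b) - g (C (E' \ ω) a')))
    rw [hD', ← h]
    refine Finset.sum_congr rfl fun ω hω => ?_
    rw [Finset.mem_filter, Finset.mem_powerset] at hω
    rw [Finset.sdiff_sdiff_eq_self hω.1]
  rw [Finset.sum_add_distrib, hswap, ← Finset.sum_add_distrib]
  have hsym : ∀ ω, f (C ω a') * (g (C ω a') - g (C (E' \ ω) b)) + f (C (E' \ ω) b) * (g (C (E' \ ω) b) - g (C ω a')) =
      (f (C ω a') - f (C (E' \ ω) b)) * ((g (C ω a') - g ∅) - (g (C (E' \ ω) b) - g ∅)) := fun ω => by ring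
  simp only [hsym]
  -- (2) finset identities for the leaf edge
  have hsdiff_ins : ∀ ω, ω ⊆ E → E' \ insert e ω = E \ ω := by
    intro ω hω; ext i
    simp only [hE', Finset.mem_sdiff, Finset.mem_insert, not_or]
    constructor
    · rintro ⟨h1, h2, h3⟩; rcases h1 with h1 | h1; exact absurd h1 h2; exact ⟨h1, h3⟩
    · rintro ⟨h1, h2⟩; exact ⟨Or.inr h1, fun h => he (h ▸ h1), h2⟩
  have hsdiff : ∀ ω, ω ⊆ E → E' \ ω = insert e (E \ ω) := by
    intro ω hω; ext i
    simp only [hE', Finset.mem_sdiff, Finset.mem_insert]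
    constructor
    · rintro ⟨h1, h2⟩; rcases h1 with h1 | h1; exact Or.inl h1; exact Or.inr ⟨h1, h2⟩
    · rintro (h1 | ⟨h1, h2⟩); exact ⟨Or.inl h1, fun h => he (h1 ▸ hω h)⟩; exact ⟨Or.inr h1, h2⟩
  -- (3) cluster identities (ω ⊆ E)
  have ha'c : ∀ c, c ⊆ E → ∀ i ∈ c, a' ∉ ends i := fun c hc i hi => ha'E i (hc hi)
  have cl_root0 : ∀ c, c ⊆ E → C c a' = {a'} := fun c hc => openCluster_eq_singleton_of_no_edge_at ends c (ha'c c hc)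
  have cl_root1 : ∀ c, c ⊆ E → C (insert e c) a' = insert a' (C c a) := fun c hc => openCluster_leaf_root_insert ends c hends (ha'c c hc)
  have cl_other : ∀ c, c ⊆ E → C (insert e c) b ⊆ C c b ∪ {y | y = a' ∧ a ∈ C c b} :=
    fun c hc => openCluster_leaf_other_insert_subset ends c hends (ha'c c hc) ha'a ha'b.symm
  have cl_other_eq : ∀ c, c ⊆ E → a ∉ C c b → C (insert e c) b = C c b := by
    intro c hc hac
    apply Set.Subset.antisymm
    · intro y hy; rcases cl_other c hc hy with h | ⟨_, h⟩; exact h; exact absurd h hac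
    · exact hCmono b (Finset.subset_insert e c)
  have cl_union1 : ∀ c, c ⊆ E → C (insert e c) a' ∪ C (insert e c) b = insert a' (C c a ∪ C c b) := by
    intro c hc
    rw [cl_root1 c hc]
    apply Set.Subset.antisymm
    · intro y hy
      rcases hy with hy | hy
      · rcases hy with hy | hy; exact Or.inl hy; exact Or.inr (Or.inl hy)
      · rcases cl_other c hc hy with h | ⟨h, _⟩; exact Or.inr (Or.inr h); exact Or.inl h
    · intro y hy
      rcases hy with hy | hy
      · exact Or.inl (Or.inl hy)
      · rcases hy with hy | hy; exact Or.inl (Or.inr hy); exact Or.inr (hCmono b (Finset.subset_insert e c) hy)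
  have cl_union0 : ∀ c, c ⊆ E → C c a' ∪ C c b = insert a' (C c b) := by
    intro c hc; rw [cl_root0 c hc]; rfl
  -- (4) split all sums over `E'.powerset` along the colour of `e`
  rw [hD', Finset.sum_filter, hE', Finset.sum_powerset_insert he, Finset.sum_powerset_insert he]
  -- name the four pieces as sums over `E.powerset`
  -- Harris-1 (e blue) and Harris-2 (e red)
  have H1 : ∑ ω ∈ E.powerset, f (C ω a' ∪ C ω b) * (g (C ω a' ∪ C ω b) - g ∅) =
      ∑ ω ∈ E.powerset, f (insert a' (C ω b)) * (g (insert a' (C ω b)) - g ∅) :=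
    Finset.sum_congr rfl fun ω hω => by rw [cl_union0 ω (Finset.mem_powerset.mp hω)]
  have H2 : ∑ ω ∈ E.powerset, f (C (insert e ω) a' ∪ C (insert e ω) b) * (g (C (insert e ω) a' ∪ C (insert e ω) b) - g ∅) =
      ∑ ω ∈ E.powerset, f (insert a' (C ω a ∪ C ω b)) * (g (insert a' (C ω a ∪ C ω b)) - g ∅) :=
    Finset.sum_congr rfl fun ω hω => by rw [cl_union1 ω (Finset.mem_powerset.mp hω)]
  -- kernel, e blue: wall ⟺ a ∉ C (E \ ω) b ; term with P' = {a'}, Q' = C (E \ ω) b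
  have KB : ∑ ω ∈ E.powerset, (if b ∉ C ω a' ∧ b ∉ C (insert e E \ ω) a' then
        (f (C ω a') - f (C (insert e E \ ω) b)) * ((g (C ω a') - g ∅) - (g (C (insert e E \ ω) b) - g ∅)) else 0) =
      ∑ ω ∈ E.powerset, (if a ∉ C (E \ ω) b then
        (f {a'} - f (C (E \ ω) b)) * ((g {a'} - g ∅) - (g (C (E \ ω) b) - g ∅)) else 0) := by
    refine Finset.sum_congr rfl fun ω hω => ?_
    have hω := Finset.mem_powerset.mp hω
    have hsd := hsdiff ω hω
    rw [← hE', hsd, cl_root0 ω hω, cl_root1 (E \ ω) Finset.sdiff_subset]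
    have hiff : (b ∉ ({a'} : Set V) ∧ b ∉ insert a' (C (E \ ω) a)) ↔ a ∉ C (E \ ω) b := by
      rw [Set.mem_singleton_iff, Set.mem_insert_iff, mem_openCluster_comm ends (E \ ω) a b]
      constructor
      · rintro ⟨_, h⟩; exact fun h' => h (Or.inr h')
      · intro h; exact ⟨ha'b.symm, fun h' => h'.elim (fun h'' => ha'b.symm h'') h⟩
    by_cases hw : a ∉ C (E \ ω) b
    · rw [if_pos (hiff.mpr hw), if_pos hw, cl_other_eq (E \ ω) Finset.sdiff_subset hw]
    · rw [if_neg (fun h => hw (hiff.mp h)), if_neg hw]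
  -- kernel, e red: wall ⟺ b ∉ C ω a ; term with P' = insert a' (C ω a), Q' = C (E \ ω) b
  have KR : ∑ ω ∈ E.powerset, (if b ∉ C (insert e ω) a' ∧ b ∉ C (insert e E \ insert e ω) a' then
        (f (C (insert e ω) a') - f (C (insert e E \ insert e ω) b)) *
          ((g (C (insert e ω) a') - g ∅) - (g (C (insert e E \ insert e ω) b) - g ∅)) else 0) =
      ∑ ω ∈ E.powerset, (if b ∉ C ω a then
        (f (insert a' (C ω a)) - f (C (E \ ω) b)) * ((g (insert a' (C ω a)) - g ∅) - (g (C (E \ ω) b) - g ∅)) else 0) := by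
    refine Finset.sum_congr rfl fun ω hω => ?_
    have hω := Finset.mem_powerset.mp hω
    rw [← hE', hsdiff_ins ω hω, cl_root1 ω hω, cl_root0 (E \ ω) Finset.sdiff_subset]
    have hiff : (b ∉ insert a' (C ω a) ∧ b ∉ ({a'} : Set V)) ↔ b ∉ C ω a := by
      rw [Set.mem_singleton_iff, Set.mem_insert_iff]
      constructor
      · rintro ⟨h, _⟩; exact fun h' => h (Or.inr h')
      · intro h; exact ⟨fun h' => h'.elim (fun h'' => ha'b.symm h'') h, ha'b.symm⟩
    by_cases hw : b ∉ C ω a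
    · rw [if_pos (hiff.mpr hw), if_pos hw]
    · rw [if_neg (fun h => hw (hiff.mp h)), if_neg hw]
  rw [H1, H2, KB, KR]
  -- (5) the estimates.  Notation: h₁ X = f (insert a' X), k₁ X = g (insert a' X) - g ∅, k₀ X = g X - g ∅.
  have h1_ge : ∀ X : Set V, f X ≤ f (insert a' X) := fun X => hf (Set.subset_insert _ _)
  have k1_ge : ∀ X : Set V, g X - g ∅ ≤ g (insert a' X) - g ∅ := fun X => by linarith [hg (Set.subset_insert a' X)]
  -- (i) e-blue kernel + Harris-1 off ℜ
  have step_i : 0 ≤ ∑ ω ∈ E.powerset, ((if a ∉ C (E \ ω) b then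
        (f {a'} - f (C (E \ ω) b)) * ((g {a'} - g ∅) - (g (C (E \ ω) b) - g ∅)) else 0)
        + (if a ∉ C (E \ ω) b then f (insert a' (C (E \ ω) b)) * (g (insert a' (C (E \ ω) b)) - g ∅) else 0)) := by
    refine Finset.sum_nonneg fun ω _ => ?_
    by_cases hw : a ∉ C (E \ ω) b
    · rw [if_pos hw, if_pos hw]
      have := mul_add_sub_mul_sub_nonneg (A := f (insert a' (C (E \ ω) b))) (B := g (insert a' (C (E \ ω) b)) - g ∅)
        (α := f {a'}) (β := f (C (E \ ω) b)) (γ := g {a'} - g ∅) (δ := g (C (E \ ω) b) - g ∅)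
        (hf_nonneg _) (hf (by intro y hy; rw [Set.mem_singleton_iff] at hy; rw [hy]; exact Set.mem_insert _ _))
        (hf_nonneg _) (h1_ge _) (hk_nonneg _)
        (by linarith [hg (show ({a'} : Set V) ⊆ insert a' (C (E \ ω) b) from by
              intro y hy; rw [Set.mem_singleton_iff] at hy; rw [hy]; exact Set.mem_insert _ _)])
        (hk_nonneg _) (k1_ge _)
      linarith
    · rw [if_neg hw, if_neg hw]; linarith
  -- the Harris-1 piece used in (i), re-indexed by the swap: Σ_{a ∉ C(E\ω) b} h₁k₁(C (E\ω) b) = Σ_{a ∉ C ω b} h₁k₁(C ω b)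
  have swap_i : ∑ ω ∈ E.powerset, (if a ∉ C (E \ ω) b then f (insert a' (C (E \ ω) b)) * (g (insert a' (C (E \ ω) b)) - g ∅) else 0) =
      ∑ ω ∈ E.powerset, (if a ∉ C ω b then f (insert a' (C ω b)) * (g (insert a' (C ω b)) - g ∅) else 0) :=
    sum_powerset_sdiff E (fun ω => if a ∉ C ω b then f (insert a' (C ω b)) * (g (insert a' (C ω b)) - g ∅) else 0)
  -- Harris-1 splits into the parts `a ∉ C ω b` and `a ∈ C ω b`
  have H1split : ∑ ω ∈ E.powerset, f (insert a' (C ω b)) * (g (insert a' (C ω b)) - g ∅) =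
      ∑ ω ∈ E.powerset, (if a ∉ C ω b then f (insert a' (C ω b)) * (g (insert a' (C ω b)) - g ∅) else 0)
      + ∑ ω ∈ E.powerset, (if a ∈ C ω b then f (insert a' (C ω b)) * (g (insert a' (C ω b)) - g ∅) else 0) := by
    rw [← Finset.sum_add_distrib]
    refine Finset.sum_congr rfl fun ω _ => ?_
    by_cases h : a ∈ C ω b
    · rw [if_neg (not_not.mpr h), if_pos h]; ring
    · rw [if_pos h, if_neg h]; ring
  -- (ii)+(iii): the e-red kernel splits into the wall part `T_H` and the part `a ∈ C(E\ω) b`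
  have KRsplit : ∑ ω ∈ E.powerset, (if b ∉ C ω a then
        (f (insert a' (C ω a)) - f (C (E \ ω) b)) * ((g (insert a' (C ω a)) - g ∅) - (g (C (E \ ω) b) - g ∅)) else 0) =
      ∑ ω ∈ E.powerset.filter (fun ω => b ∉ C ω a ∧ b ∉ C (E \ ω) a),
        (f (insert a' (C ω a)) - f (C (E \ ω) b)) * ((g (insert a' (C ω a)) - g ∅) - (g (C (E \ ω) b) - g ∅))
      + ∑ ω ∈ E.powerset, (if b ∉ C ω a ∧ a ∈ C (E \ ω) b then
        (f (insert a' (C ω a)) - f (C (E \ ω) b)) * ((g (insert a' (C ω a)) - g ∅) - (g (C (E \ ω) b) - g ∅)) else 0) := by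
    rw [Finset.sum_filter, ← Finset.sum_add_distrib]
    refine Finset.sum_congr rfl fun ω _ => ?_
    by_cases h1 : b ∉ C ω a
    · by_cases h2 : a ∈ C (E \ ω) b
      · have h2' : ¬ (b ∉ C (E \ ω) a) := fun h => h ((mem_openCluster_comm ends (E \ ω) a b).mpr h2)
        rw [if_pos h1, if_neg (fun h => h2' h.2), if_pos ⟨h1, h2⟩]; ring
      · have h2' : b ∉ C (E \ ω) a := fun h => h2 ((mem_openCluster_comm ends (E \ ω) a b).mp h)
        rw [if_pos h1, if_pos ⟨h1, h2'⟩, if_neg (fun h => h2 h.2)]; ring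
    · rw [if_neg h1, if_neg (fun h => h1 h.1), if_neg (fun h => h1 h.1)]; ring
  -- (ii) the wall part against Harris-2 on ψ(T_H)
  set T : Finset (Finset ι) := E.powerset.filter (fun ω => b ∉ C ω a ∧ b ∉ C (E \ ω) a) with hT
  have hTmem : ∀ {ω}, ω ∈ T ↔ ω ⊆ E ∧ b ∉ C ω a ∧ b ∉ C (E \ ω) a := fun {ω} => by
    rw [hT, Finset.mem_filter, Finset.mem_powerset]
  set Y : Finset ι → ℝ := fun ω => f (insert a' (C ω a ∪ C ω b)) * (g (insert a' (C ω a ∪ C ω b)) - g ∅) with hY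
  have hY0 : ∀ ω, 0 ≤ Y ω := fun ω => mul_nonneg (hf_nonneg _) (hk_nonneg _)
  have step_ii : 0 ≤ ∑ ω ∈ T, ((f (insert a' (C ω a)) - f (C (E \ ω) b)) * ((g (insert a' (C ω a)) - g ∅) - (g (C (E \ ω) b) - g ∅))
      + Y (ψ ω)) := by
    refine Finset.sum_nonneg fun ω hω => ?_
    obtain ⟨s1, r1, b1⟩ := hTmem.mp hω
    have hcov := hψcov ω s1 r1 b1
    have hPa : C ω a ⊆ C (ψ ω) a ∪ C (ψ ω) b := fun y hy => hcov (Or.inl hy)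
    have hQb : C (E \ ω) b ⊆ C (ψ ω) a ∪ C (ψ ω) b := fun y hy => hcov (Or.inr hy)
    have hPa' : insert a' (C ω a) ⊆ insert a' (C (ψ ω) a ∪ C (ψ ω) b) := Set.insert_subset_insert hPa
    have hQb' : C (E \ ω) b ⊆ insert a' (C (ψ ω) a ∪ C (ψ ω) b) := fun y hy => Set.mem_insert_of_mem _ (hQb hy)
    have := mul_add_sub_mul_sub_nonneg (A := f (insert a' (C (ψ ω) a ∪ C (ψ ω) b))) (B := g (insert a' (C (ψ ω) a ∪ C (ψ ω) b)) - g ∅)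
      (α := f (insert a' (C ω a))) (β := f (C (E \ ω) b)) (γ := g (insert a' (C ω a)) - g ∅) (δ := g (C (E \ ω) b) - g ∅)
      (hf_nonneg _) (hf hPa') (hf_nonneg _) (hf hQb')
      (hk_nonneg _) (by linarith [hg hPa']) (hk_nonneg _) (by linarith [hg hQb'])
    simp only [hY]; linarith
  -- Harris-2 ≥ its part on ψ(T) plus its part on ℜ = {b ∈ C ω a}
  have H2lower : ∑ ω ∈ T, Y (ψ ω) + ∑ ω ∈ E.powerset, (if b ∈ C ω a then Y ω else 0) ≤ ∑ ω ∈ E.powerset, Y ω := by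
    have hinj : ∀ ω₁ ∈ T, ∀ ω₂ ∈ T, ψ ω₁ = ψ ω₂ → ω₁ = ω₂ := by
      intro ω₁ h₁ ω₂ h₂ h
      obtain ⟨s1, r1, b1⟩ := hTmem.mp h₁
      obtain ⟨s2, r2, b2⟩ := hTmem.mp h₂
      exact hψinj ω₁ ω₂ s1 r1 b1 s2 r2 b2 h
    have e1 : ∑ ω ∈ T, Y (ψ ω) = ∑ ω' ∈ T.image ψ, Y ω' := (Finset.sum_image (f := fun ω' => Y ω') hinj).symm
    rw [e1, ← Finset.sum_filter]
    have hdisj : Disjoint (T.image ψ) (E.powerset.filter (fun ω => b ∈ C ω a)) := by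
      rw [Finset.disjoint_left]
      intro ω' h1 h2
      rw [Finset.mem_image] at h1
      obtain ⟨ω, hω, rfl⟩ := h1
      obtain ⟨s1, r1, b1⟩ := hTmem.mp hω
      exact hψprop ω s1 r1 b1 (Finset.mem_filter.mp h2).2
    rw [← Finset.sum_union hdisj]
    refine Finset.sum_le_sum_of_subset_of_nonneg ?_ (fun ω _ _ => hY0 ω)
    intro ω' hω'
    rcases Finset.mem_union.mp hω' with h | h
    · rw [Finset.mem_image] at h
      obtain ⟨ω, hω, rfl⟩ := h
      obtain ⟨s1, r1, b1⟩ := hTmem.mp hω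
      exact Finset.mem_powerset.mpr (hψE ω s1 r1 b1)
    · exact (Finset.mem_filter.mp h).1
  -- (iii) the part `b ∉ C ω a ∧ a ∈ C(E\ω) b`: two cross terms, each dominated through one two-colouring Harris inequality
  -- first cross term: F = h₁(C ω a), G = k₀(S ω)·1[b ∈ C ω a ∧ a ∉ C(E\ω) b]
  have cross1 : ∑ ω ∈ E.powerset, (if b ∉ C ω a ∧ a ∈ C (E \ ω) b then f (insert a' (C ω a)) * (g (C (E \ ω) b) - g ∅) else 0)
      ≤ ∑ ω ∈ E.powerset, (if b ∈ C ω a then Y ω else 0) := by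
    set F : Finset ι → ℝ := fun ω => f (insert a' (C ω a)) with hF
    set G : Finset ι → ℝ := fun ω => if b ∈ C ω a ∧ a ∉ C (E \ ω) b then g (C ω a ∪ C ω b) - g ∅ else 0 with hG
    have hFm : Monotone F := fun ω ω' h => hf (Set.insert_subset_insert (hCmono a h))
    have hGm : Monotone G := by
      intro ω ω' h
      simp only [hG]
      by_cases h1 : b ∈ C ω a ∧ a ∉ C (E \ ω) b
      · have h1' : b ∈ C ω' a ∧ a ∉ C (E \ ω') b :=
          ⟨hCmono a h h1.1, fun h' => h1.2 (hCmono b (Finset.sdiff_subset_sdiff (le_refl E) h) h')⟩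
        rw [if_pos h1, if_pos h1']
        linarith [hg (Set.union_subset_union (hCmono a h) (hCmono b h))]
      · rw [if_neg h1]
        by_cases h2 : b ∈ C ω' a ∧ a ∉ C (E \ ω') b
        · rw [if_pos h2]; exact hk_nonneg _
        · rw [if_neg h2]
    have key := sum_mul_sdiff_le_sum_mul E F G hFm hGm
    have lhs_eq : ∑ ω ∈ E.powerset, F ω * G (E \ ω) =
        ∑ ω ∈ E.powerset, (if b ∉ C ω a ∧ a ∈ C (E \ ω) b then f (insert a' (C ω a)) * (g (C (E \ ω) b) - g ∅) else 0) := by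
      refine Finset.sum_congr rfl fun ω hω => ?_
      have hω := Finset.mem_powerset.mp hω
      simp only [hF, hG]
      rw [Finset.sdiff_sdiff_eq_self hω]
      by_cases h1 : b ∉ C ω a ∧ a ∈ C (E \ ω) b
      · have hba : b ∈ C (E \ ω) a := (mem_openCluster_comm ends (E \ ω) a b).mpr h1.2
        have hab' : a ∉ C ω b := fun h => h1.1 ((mem_openCluster_comm ends ω a b).mpr h)
        have hU : C (E \ ω) a ∪ C (E \ ω) b = C (E \ ω) b := by
          apply Set.union_eq_right.mpr
          intro y hy
          exact SimpleGraph.Reachable.trans (SimpleGraph.Reachable.symm hba) hy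
        rw [if_pos ⟨hba, hab'⟩, if_pos h1, hU]
      · have h1' : ¬ (b ∈ C (E \ ω) a ∧ a ∉ C ω b) := by
          intro h; apply h1
          exact ⟨fun h' => h.2 ((mem_openCluster_comm ends ω a b).mp h'), (mem_openCluster_comm ends (E \ ω) a b).mp h.1⟩
        rw [if_neg h1', if_neg h1, mul_zero]
    have rhs_le : ∑ ω ∈ E.powerset, F ω * G ω ≤ ∑ ω ∈ E.powerset, (if b ∈ C ω a then Y ω else 0) := by
      refine Finset.sum_le_sum fun ω _ => ?_
      simp only [hF, hG, hY]
      by_cases h1 : b ∈ C ω a ∧ a ∉ C (E \ ω) b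
      · rw [if_pos h1, if_pos h1.1]
        have u1 : f (insert a' (C ω a)) ≤ f (insert a' (C ω a ∪ C ω b)) := hf (Set.insert_subset_insert Set.subset_union_left)
        have u2 : g (C ω a ∪ C ω b) - g ∅ ≤ g (insert a' (C ω a ∪ C ω b)) - g ∅ := k1_ge _
        exact mul_le_mul u1 u2 (hk_nonneg _) (hf_nonneg _)
      · rw [if_neg h1, mul_zero]
        by_cases h2 : b ∈ C ω a
        · rw [if_pos h2]; exact hY0 ω
        · rw [if_neg h2]
    linarith
  -- second cross term: F = k₁(C ω a), G = h₀(S ω)·1[...]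
  have cross2 : ∑ ω ∈ E.powerset, (if b ∉ C ω a ∧ a ∈ C (E \ ω) b then (g (insert a' (C ω a)) - g ∅) * f (C (E \ ω) b) else 0)
      ≤ ∑ ω ∈ E.powerset, (if a ∈ C ω b then f (insert a' (C ω b)) * (g (insert a' (C ω b)) - g ∅) else 0) := by
    set F : Finset ι → ℝ := fun ω => g (insert a' (C ω a)) - g ∅ with hF
    set G : Finset ι → ℝ := fun ω => if b ∈ C ω a ∧ a ∉ C (E \ ω) b then f (C ω a ∪ C ω b) else 0 with hG
    have hFm : Monotone F := fun ω ω' h => by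
      simp only [hF]
      linarith [hg (show insert a' (C ω a) ⊆ insert a' (C ω' a) from Set.insert_subset_insert (hCmono a h))]
    have hGm : Monotone G := by
      intro ω ω' h
      simp only [hG]
      by_cases h1 : b ∈ C ω a ∧ a ∉ C (E \ ω) b
      · have h1' : b ∈ C ω' a ∧ a ∉ C (E \ ω') b :=
          ⟨hCmono a h h1.1, fun h' => h1.2 (hCmono b (Finset.sdiff_subset_sdiff (le_refl E) h) h')⟩
        rw [if_pos h1, if_pos h1']
        exact hf (Set.union_subset_union (hCmono a h) (hCmono b h))
      · rw [if_neg h1]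
        by_cases h2 : b ∈ C ω' a ∧ a ∉ C (E \ ω') b
        · rw [if_pos h2]; exact hf_nonneg _
        · rw [if_neg h2]
    have key := sum_mul_sdiff_le_sum_mul E F G hFm hGm
    have lhs_eq : ∑ ω ∈ E.powerset, F ω * G (E \ ω) =
        ∑ ω ∈ E.powerset, (if b ∉ C ω a ∧ a ∈ C (E \ ω) b then (g (insert a' (C ω a)) - g ∅) * f (C (E \ ω) b) else 0) := by
      refine Finset.sum_congr rfl fun ω hω => ?_
      have hω := Finset.mem_powerset.mp hω
      simp only [hF, hG]
      rw [Finset.sdiff_sdiff_eq_self hω]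
      by_cases h1 : b ∉ C ω a ∧ a ∈ C (E \ ω) b
      · have hba : b ∈ C (E \ ω) a := (mem_openCluster_comm ends (E \ ω) a b).mpr h1.2
        have hab' : a ∉ C ω b := fun h => h1.1 ((mem_openCluster_comm ends ω a b).mpr h)
        have hU : C (E \ ω) a ∪ C (E \ ω) b = C (E \ ω) b := by
          apply Set.union_eq_right.mpr
          intro y hy
          exact SimpleGraph.Reachable.trans (SimpleGraph.Reachable.symm hba) hy
        rw [if_pos ⟨hba, hab'⟩, if_pos h1, hU]
      · have h1' : ¬ (b ∈ C (E \ ω) a ∧ a ∉ C ω b) := by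
          intro h; apply h1
          exact ⟨fun h' => h.2 ((mem_openCluster_comm ends ω a b).mp h'), (mem_openCluster_comm ends (E \ ω) a b).mp h.1⟩
        rw [if_neg h1', if_neg h1, mul_zero]
    have rhs_le : ∑ ω ∈ E.powerset, F ω * G ω ≤
        ∑ ω ∈ E.powerset, (if a ∈ C ω b then f (insert a' (C ω b)) * (g (insert a' (C ω b)) - g ∅) else 0) := by
      refine Finset.sum_le_sum fun ω _ => ?_
      simp only [hF, hG]
      by_cases h1 : b ∈ C ω a ∧ a ∉ C (E \ ω) b
      · have hab' : a ∈ C ω b := (mem_openCluster_comm ends ω a b).mp h1.1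
        have hU : C ω a ∪ C ω b = C ω b := by
          apply Set.union_eq_right.mpr
          intro y hy
          exact SimpleGraph.Reachable.trans (SimpleGraph.Reachable.symm h1.1) hy
        rw [if_pos h1, if_pos hab', hU]
        have u1 : f (C ω b) ≤ f (insert a' (C ω b)) := h1_ge _
        have u2 : g (insert a' (C ω a)) - g ∅ ≤ g (insert a' (C ω b)) - g ∅ := by
          have : C ω a ⊆ C ω b := fun y hy => SimpleGraph.Reachable.trans (SimpleGraph.Reachable.symm h1.1) hy
          linarith [hg (show insert a' (C ω a) ⊆ insert a' (C ω b) from Set.insert_subset_insert this)]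
        nlinarith [hf_nonneg (C ω b), hk_nonneg (insert a' (C ω a)), hf_nonneg (insert a' (C ω b)), u1, u2]
      · rw [if_neg h1, mul_zero]
        by_cases h2 : a ∈ C ω b
        · rw [if_pos h2]; exact mul_nonneg (hf_nonneg _) (hk_nonneg _)
        · rw [if_neg h2]
    linarith
  -- (iii) assembled: the remaining kernel part is ≥ −(cross1 + cross2)
  have step_iii : -(∑ ω ∈ E.powerset, (if b ∉ C ω a ∧ a ∈ C (E \ ω) b then f (insert a' (C ω a)) * (g (C (E \ ω) b) - g ∅) else 0))
      - (∑ ω ∈ E.powerset, (if b ∉ C ω a ∧ a ∈ C (E \ ω) b then (g (insert a' (C ω a)) - g ∅) * f (C (E \ ω) b) else 0))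
      ≤ ∑ ω ∈ E.powerset, (if b ∉ C ω a ∧ a ∈ C (E \ ω) b then
        (f (insert a' (C ω a)) - f (C (E \ ω) b)) * ((g (insert a' (C ω a)) - g ∅) - (g (C (E \ ω) b) - g ∅)) else 0) := by
    rw [← Finset.sum_neg_distrib, ← Finset.sum_sub_distrib]
    refine Finset.sum_le_sum fun ω _ => ?_
    by_cases h1 : b ∉ C ω a ∧ a ∈ C (E \ ω) b
    · rw [if_pos h1, if_pos h1, if_pos h1]
      nlinarith [hf_nonneg (insert a' (C ω a)), hf_nonneg (C (E \ ω) b), hk_nonneg (insert a' (C ω a)), hk_nonneg (C (E \ ω) b),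
        mul_nonneg (hf_nonneg (insert a' (C ω a))) (hk_nonneg (insert a' (C ω a))),
        mul_nonneg (hf_nonneg (C (E \ ω) b)) (hk_nonneg (C (E \ ω) b))]
    · rw [if_neg h1, if_neg h1, if_neg h1]; linarith
  -- final assembly
  rw [Finset.sum_add_distrib] at step_i step_ii
  rw [swap_i] at step_i
  rw [H1split, KRsplit]
  have hYsum : ∑ ω ∈ E.powerset, f (insert a' (C ω a ∪ C ω b)) * (g (insert a' (C ω a ∪ C ω b)) - g ∅) = ∑ ω ∈ E.powerset, Y ω := rfl
  rw [hYsum]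
  linarith [cross1, cross2, step_iii, H2lower, step_i, step_ii]


end Coefficientwise

end Summit.CriticalPhenomena.PercolationContinuityZ3.Theorems
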